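import Summits.Langlands.Langlands.Theorems.SqrtFiveQuarticCoversSectorComplementPosition
import Summits.Langlands.Langlands.Theorems.SqrtFiveQuarticCoversGroupCensusFive

/-!
# `SqrtFiveQuarticCovers.Target` modulo the one open crux and five printed theorems
# (CONDITIONAL bookkeeping; `--supports stmt-Langlands-17832 --as helper`; closes nothing)

Route `Langlands/SqrtFiveQuarticCovers`.  Composition of two landed pieces:
`SqrtFiveQuarticCovers.target_of_cruxes_of_Box2022` (eng-6, p648447: `Target` from the two cruxes
`RefinedLocusModular`, `ReductionToRefinedLocus` and Box 2022 Thms. 1.5, 1.1 as named facts) and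
`GroupCensusFive.reductionToRefinedLocus_of_liftingTheorems` (this seat, p652735: the crux
`ReductionToRefinedLocus` from FLS 2015 Thms. 3–4 and Kalyanswamy 2018 Thm. 1.2 as named facts,
through the PROVED finite census `GroupCensusFive`).  Result: the route's `Target` — every elliptic
curve over every totally real quartic field is modular (trace-only sense, written out) — follows
from the ONE genuinely open crux `RefinedLocusModular` (the finite certificate on the eight
determinant-refined curves, object of the cell `pub/lg-quartmod`) and FIVE printed theorems present
in the tree as named facts.  HONEST STATUS: conditional; nothing here proves modularity of any
curve; the five facts are cited, not proved (D-0014).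

References: [Box2022] Thms. 1.1, 1.5, 7.1; [FreitasLeHungSiksek2015] Thms. 3–4 and Remark (iii)
after Cor. 2.1; [Kalyanswamy2018] Thm. 1.2.
-/

set_option linter.dupNamespace false -- project-wide option (lakefile weak.linter.dupNamespace); `Summit.Langlands.Langlands` is the mandated namespace

namespace Summit.Langlands.Langlands.Theorems.SqrtFiveQuarticCovers

open Literature.NumberTheory.Automorphic Summit.Langlands.Langlands.Theses.SqrtFiveQuarticCovers

/-- **`Target` ⇐ `RefinedLocusModular` + five printed theorems.** Every elliptic curve over every
totally real quartic number field is modular (the route's `Target`, trace-only sense), GIVEN the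
finite certificate `RefinedLocusModular` (hypothesis — the open crux) and the named facts
`Box2022_theorem1_1`, `Box2022_theorem1_5_modular`, `FLS2015_theorem3`, `FLS2015_theorem4`,
`Kalyanswamy2018_theorem1_2`.  CONDITIONAL; one-line composition of `target_of_cruxes_of_Box2022`
with `GroupCensusFive.reductionToRefinedLocus_of_liftingTheorems`.
[cite: Box2022, Thms. 1.1, 1.5 and 7.1] [cite: FreitasLeHungSiksek2015, Thms. 3–4] -/
theorem target_of_refinedLocusModular_of_facts (h₂ : RefinedLocusModular)
    (h11 : Box2022_theorem1_1) (h15 : Box2022_theorem1_5_modular) (h3 : FLS2015_theorem3)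
    (h4 : FLS2015_theorem4) (hKal : Kalyanswamy2018_theorem1_2) : Target :=
  target_of_cruxes_of_Box2022 h₂
    (Summit.Langlands.Langlands.Theorems.GroupCensusFive.reductionToRefinedLocus_of_liftingTheorems
      h3 h4 hKal) h15 h11

end Summit.Langlands.Langlands.Theorems.SqrtFiveQuarticCovers
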